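import Literature.Probability.RandomPlanarGeometry.WholePlaneSLE
import Literature.Probability.RandomPlanarGeometry.WholePlaneLoewnerBackwardChain
import Literature.Probability.Process.BrownianMotionComplexProofs
import HarnessLib

/-!
# Whole-plane SLE_κ: the driving data exist (probability plumbing of `IsWholePlaneSLE.exists`)

Topic `Probability/RandomPlanarGeometry`; theorems only, sequel of `WholePlaneSLE`. The named fact
`IsWholePlaneSLE.exists` (G. F. Lawler, *Conformally Invariant Processes in the Plane* (2005),
Def. 6.28 and Prop. 4.21; J. Miller, S. Sheffield, *Imaginary geometry IV* (2017), Prop. 2.5 with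
`ρ = 0`) asks for a probability space carrying two independent Brownian motions `B¹, B²`
(Mathlib's `IsBrownianReal`), an independent phase `Y` uniform on `[0, 2π)`, and a two-sided path
`γ` with measurable marginals which almost surely generates the whole-plane Loewner chain driven by
`exp (i · twoSidedDriving κ B¹ B² Y)`. Its published proof has three layers: (1) the driving data;
(2) the whole-plane Loewner chain of the (a.s. continuous) driving angle exists — Lawler (2005),
Prop. 4.21, the named fact `WholePlaneLoewnerChain.exists_unique`, now PROVED
(`WholePlaneLoewnerChain.exists_unique_holds`, `WholePlaneLoewnerBackwardChain`); (3) the chain is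
a.s. generated by a continuous curve — Miller–Sheffield (2013), Prop. 2.5 (radial SLE_κ generated
by a curve, their Prop. 2.3 over Rohde–Schramm / Lawler–Schramm–Werner for `κ = 8`, the radial loop
Lemma 2.6 for `κ > 4`, and `T → -∞`). This file proves layers (1)–(2) and reduces the fact to
layer (3):

* `IsWholePlaneSLE.exists_drivingData` — on `Ω = ((ℝ≥0 → ℝ) × (ℝ≥0 → ℝ)) × ℝ` with
  `P = (W ⊗ W) ⊗ uniformAngleLaw` (`W` the pre-Wiener measure, a probability measure by the
  tree's Kolmogorov extension theorem) the coordinate processes `B¹ t ω = brownian t ω.1.1`,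
  `B² t ω = brownian t ω.1.2` (the tree's canonical Brownian motion, by Kolmogorov–Chentsov) and
  `Y ω = ω.2` have all the properties demanded by `IsWholePlaneSLE` — Brownian
  (`IsBrownianReal.comp_measurePreserving`), measurable marginals, `Y ~ uniformAngleLaw`,
  `B¹ ⊥ B²` and `(B¹, B²) ⊥ Y` (Mathlib's `indepFun_prod`, transported along the projection by
  `IndepFun.comp_measurePreserving` proved here) — and moreover EVERY path is continuous with
  `B¹₀ = B²₀ = 0`, so every two-sided driving angle is continuous (`continuous_twoSidedDriving`)
  and every whole-plane Loewner chain exists (layer (2));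
* `IsWholePlaneSLE.exists_of_forall_drivingData` — **the named fact follows from layer (3)**: if
  for every such driving data (on any probability space) there is a path with measurable marginals
  a.s. generating the chain, then `IsWholePlaneSLE.exists`.

No definition and no named fact is introduced.

## References

* G. F. Lawler, *Conformally Invariant Processes in the Plane*, AMS (2005), §6.6 Def. 6.28
  (two-sided Brownian driving function with uniform phase), §4.3 Prop. 4.21. [Lawler2005]
* J. Miller, S. Sheffield, *Imaginary geometry IV*, PTRF 169 (2017), arXiv:1302.4738, §2.1.3,
  Prop. 2.5. [MillerSheffield2013]
* O. Kallenberg, *Foundations of Modern Probability* (2002), Thm 13.5, Lemma 3.10. [Kallenberg2002]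
-/

noncomputable section

open Set Filter MeasureTheory ProbabilityTheory
open scoped NNReal Topology

/-! ### Transport of independence along a measure-preserving map -/

namespace ProbabilityTheory

/-- Independence pulls back along a measure-preserving map: if `f ⊥ g` under `μ` and
`φ : (Ω', ν) → (Ω, μ)` is measure preserving then `f ∘ φ ⊥ g ∘ φ` under `ν` (the joint law and the
marginal laws are image measures, Kallenberg (2002), Lemma 1.22 / Lemma 3.10). Dot-notation
extension declared in Mathlib's namespace `ProbabilityTheory.IndepFun`. [folklore] -/
theorem IndepFun.comp_measurePreserving {Ω Ω' β β' : Type*} {mΩ : MeasurableSpace Ω}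
    {mΩ' : MeasurableSpace Ω'} [MeasurableSpace β] [MeasurableSpace β'] {μ : Measure Ω}
    {ν : Measure Ω'} [IsProbabilityMeasure μ] [IsProbabilityMeasure ν] {f : Ω → β} {g : Ω → β'}
    {φ : Ω' → Ω} (h : IndepFun f g μ) (hφ : MeasurePreserving φ ν μ) (hf : Measurable f)
    (hg : Measurable g) : IndepFun (f ∘ φ) (g ∘ φ) ν := by
  rw [indepFun_iff_map_prod_eq_prod_map_map hf.aemeasurable hg.aemeasurable] at h
  rw [indepFun_iff_map_prod_eq_prod_map_map (hf.comp hφ.measurable).aemeasurable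
    (hg.comp hφ.measurable).aemeasurable]
  have h1 : ν.map (fun ω ↦ ((f ∘ φ) ω, (g ∘ φ) ω)) = μ.map fun ω ↦ (f ω, g ω) := by
    rw [← hφ.map_eq, Measure.map_map (hf.prodMk hg) hφ.measurable]
    rfl
  rw [h1, h, ← hφ.map_eq, Measure.map_map hf hφ.measurable, Measure.map_map hg hφ.measurable]

end ProbabilityTheory

namespace Literature.Probability.RandomPlanarGeometry

variable {Ω : Type*}

/-! ### Continuity of the two-sided driving angle -/

/-- **The two-sided driving angle is continuous** at a sample point where both Brownian paths are
continuous and vanish at time `0` (the two halves `Y + √κ B¹ₜ`, `Y + √κ B²₋ₜ` are continuous and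
agree at `t = 0`). Lawler (2005), §6.6. [folklore] -/
theorem continuous_twoSidedDriving (κ : ℝ≥0) {B₁ B₂ : ℝ≥0 → Ω → ℝ} {Y : Ω → ℝ} {ω : Ω}
    (h₁ : Continuous fun t ↦ B₁ t ω) (h₂ : Continuous fun t ↦ B₂ t ω) (h₁0 : B₁ 0 ω = 0)
    (h₂0 : B₂ 0 ω = 0) : Continuous (twoSidedDriving κ B₁ B₂ Y ω) := by
  have hf : Continuous fun t : ℝ ↦ B₁ t.toNNReal ω := h₁.comp continuous_real_toNNReal
  have hg : Continuous fun t : ℝ ↦ B₂ (-t).toNNReal ω :=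
    h₂.comp (continuous_real_toNNReal.comp continuous_neg)
  have hif : Continuous fun t : ℝ ↦ if 0 ≤ t then B₁ t.toNNReal ω else B₂ (-t).toNNReal ω := by
    refine Continuous.if_le hf hg continuous_const continuous_id fun t ht ↦ ?_
    rw [← ht]
    simp [h₁0, h₂0]
  exact continuous_const.add (continuous_const.mul hif)

/-! ### The driving data -/

/-- **The driving data of whole-plane SLE_κ exist**, with everywhere continuous paths (layers
(1)–(2) of the proof of `IsWholePlaneSLE.exists`): on `Ω = ((ℝ≥0 → ℝ) × (ℝ≥0 → ℝ)) × ℝ` with the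
product of two pre-Wiener measures and the uniform angle law, the two coordinate Brownian motions
and the phase coordinate are Brownian motions (Mathlib's `IsBrownianReal`) with measurable
marginals, `Y` is uniform on `[0, 2π)`, `B¹ ⊥ B²`, `(B¹, B²) ⊥ Y`; every path is continuous and
starts at `0`, every two-sided driving angle `twoSidedDriving κ B¹ B² Y ω` is continuous, and its
whole-plane Loewner chain exists (Lawler (2005), Prop. 4.21 = `WholePlaneLoewnerChain.exists_unique_holds`).
Lawler (2005), §6.6 ("taking independent Brownian motions `B¹ₜ, B²ₜ` … and an independent `Y`").
[cite: Lawler2005, §6.6] -/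
theorem IsWholePlaneSLE.exists_drivingData (κ : ℝ≥0) :
    ∃ (Ω : Type) (_ : MeasurableSpace Ω) (P : Measure Ω) (B₁ B₂ : ℝ≥0 → Ω → ℝ) (Y : Ω → ℝ),
      IsProbabilityMeasure P ∧ IsBrownianReal B₁ P ∧ IsBrownianReal B₂ P ∧
      (∀ t, Measurable (B₁ t)) ∧ (∀ t, Measurable (B₂ t)) ∧ Measurable Y ∧
      P.map Y = uniformAngleLaw ∧
      IndepFun (fun ω t ↦ B₁ t ω) (fun ω t ↦ B₂ t ω) P ∧
      IndepFun (fun ω ↦ (fun t ↦ B₁ t ω, fun t ↦ B₂ t ω)) Y P ∧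
      (∀ ω, Continuous fun t ↦ B₁ t ω) ∧ (∀ ω, Continuous fun t ↦ B₂ t ω) ∧
      (∀ ω, B₁ 0 ω = 0) ∧ (∀ ω, B₂ 0 ω = 0) ∧
      (∀ ω, Continuous (twoSidedDriving κ B₁ B₂ Y ω)) ∧
      ∀ ω, Nonempty (WholePlaneLoewnerChain (twoSidedDriving κ B₁ B₂ Y ω)) := by
  -- the canonical Brownian motion on the pre-Wiener space
  have hW : Process.isProjectiveLimit_preWienerMeasure :=
    Process.isProjectiveLimit_preWienerMeasure_of Process.exists_isProjectiveLimit_holds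
  haveI : IsProbabilityMeasure Process.preWienerMeasure :=
    Process.isProbabilityMeasure_preWienerMeasure hW
  have hB : IsBrownianReal Process.brownian Process.preWienerMeasure :=
    Process.isBrownianReal_brownian (Process.exists_isBrownianReal_measurable_continuous_of hW
      IsPreBrownianReal.exists_modification_isBrownianReal_holds)
  have hpath : Measurable fun (ω : ℝ≥0 → ℝ) (t : ℝ≥0) ↦ Process.brownian t ω :=
    measurable_pi_lambda _ Process.measurable_brownian
  set W : Measure (ℝ≥0 → ℝ) := Process.preWienerMeasure with hWdef
  set P : Measure (((ℝ≥0 → ℝ) × (ℝ≥0 → ℝ)) × ℝ) := (W.prod W).prod uniformAngleLaw with hPdef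
  have hfst : MeasurePreserving Prod.fst P (W.prod W) := measurePreserving_fst
  have h11 : MeasurePreserving (fun ω : ((ℝ≥0 → ℝ) × (ℝ≥0 → ℝ)) × ℝ ↦ ω.1.1) P W :=
    (measurePreserving_fst (μ := W) (ν := W)).comp hfst
  have h12 : MeasurePreserving (fun ω : ((ℝ≥0 → ℝ) × (ℝ≥0 → ℝ)) × ℝ ↦ ω.1.2) P W :=
    (measurePreserving_snd (μ := W) (ν := W)).comp hfst
  -- continuity of every two-sided driving angle
  have hcont : ∀ ω : ((ℝ≥0 → ℝ) × (ℝ≥0 → ℝ)) × ℝ, Continuous (twoSidedDriving κ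
      (fun t ω ↦ Process.brownian t ω.1.1) (fun t ω ↦ Process.brownian t ω.1.2) (fun ω ↦ ω.2) ω) :=
    fun ω ↦ continuous_twoSidedDriving κ (Process.continuous_brownian ω.1.1)
      (Process.continuous_brownian ω.1.2) (congrFun Process.brownian_zero ω.1.1)
      (congrFun Process.brownian_zero ω.1.2)
  refine ⟨((ℝ≥0 → ℝ) × (ℝ≥0 → ℝ)) × ℝ, inferInstance, P, fun t ω ↦ Process.brownian t ω.1.1,
    fun t ω ↦ Process.brownian t ω.1.2, fun ω ↦ ω.2, inferInstance, ?_, ?_, ?_, ?_, measurable_snd,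
    ?_, ?_, ?_, fun ω ↦ Process.continuous_brownian ω.1.1, fun ω ↦ Process.continuous_brownian ω.1.2,
    fun ω ↦ congrFun Process.brownian_zero ω.1.1, fun ω ↦ congrFun Process.brownian_zero ω.1.2,
    hcont, fun ω ↦ (WholePlaneLoewnerChain.exists_unique_holds _ (hcont ω)).1⟩
  · exact hB.comp_measurePreserving h11
  · exact hB.comp_measurePreserving h12
  · exact fun t ↦ (Process.measurable_brownian t).comp (measurable_fst.comp measurable_fst)
  · exact fun t ↦ (Process.measurable_brownian t).comp (measurable_snd.comp measurable_fst)
  · show P.map Prod.snd = uniformAngleLaw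
    rw [hPdef, Measure.map_snd_prod, measure_univ, one_smul]
  · -- `B¹ ⊥ B²`: the two coordinates of `W ⊗ W` are independent; pull back along `fst`
    have h0 : IndepFun (fun ω : (ℝ≥0 → ℝ) × (ℝ≥0 → ℝ) ↦ fun t ↦ Process.brownian t ω.1)
        (fun ω ↦ fun t ↦ Process.brownian t ω.2) (W.prod W) := indepFun_prod hpath hpath
    exact h0.comp_measurePreserving hfst (hpath.comp measurable_fst) (hpath.comp measurable_snd)
  · -- `(B¹, B²) ⊥ Y`: the two coordinates of `(W ⊗ W) ⊗ uniformAngleLaw` are independent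
    have hpair : Measurable fun ω : (ℝ≥0 → ℝ) × (ℝ≥0 → ℝ) ↦
        (fun t ↦ Process.brownian t ω.1, fun t ↦ Process.brownian t ω.2) :=
      (hpath.comp measurable_fst).prodMk (hpath.comp measurable_snd)
    exact indepFun_prod hpair measurable_id

/-- **`IsWholePlaneSLE.exists` reduces to the continuity of whole-plane SLE_κ** (layer (3),
Miller–Sheffield (2013), Prop. 2.5 with `ρ = 0`): if for every `κ > 0` and every driving data —
a probability space with Brownian motions `B¹, B²` (measurable marginals, everywhere continuous
paths vanishing at `0`), a measurable phase `Y ~ uniformAngleLaw`, `B¹ ⊥ B²`, `(B¹, B²) ⊥ Y` —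
there is a two-sided path with measurable marginals almost surely generating the whole-plane
Loewner chain of `twoSidedDriving κ B¹ B² Y`, then whole-plane SLE_κ exists for every `κ > 0`.
(The driving data exist by `IsWholePlaneSLE.exists_drivingData`.) [cite: MillerSheffield2013, Prop. 2.5] -/
theorem IsWholePlaneSLE.exists_of_forall_drivingData
    (h : ∀ (κ : ℝ≥0), 0 < κ → ∀ (Ω : Type) [MeasurableSpace Ω] (P : Measure Ω)
      (B₁ B₂ : ℝ≥0 → Ω → ℝ) (Y : Ω → ℝ), IsProbabilityMeasure P → IsBrownianReal B₁ P →
      IsBrownianReal B₂ P → (∀ t, Measurable (B₁ t)) → (∀ t, Measurable (B₂ t)) → Measurable Y →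
      P.map Y = uniformAngleLaw → IndepFun (fun ω t ↦ B₁ t ω) (fun ω t ↦ B₂ t ω) P →
      IndepFun (fun ω ↦ (fun t ↦ B₁ t ω, fun t ↦ B₂ t ω)) Y P →
      (∀ ω, Continuous fun t ↦ B₁ t ω) → (∀ ω, Continuous fun t ↦ B₂ t ω) →
      (∀ ω, B₁ 0 ω = 0) → (∀ ω, B₂ 0 ω = 0) →
      ∃ γ : Ω → ℝ → ℂ, (∀ t, Measurable fun ω ↦ γ ω t) ∧
        ∀ᵐ ω ∂P, ∃ C : WholePlaneLoewnerChain (twoSidedDriving κ B₁ B₂ Y ω), C.IsCurve (γ ω)) :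
    IsWholePlaneSLE.exists := by
  intro κ hκ
  obtain ⟨Ω, mΩ, P, B₁, B₂, Y, hP, hB₁, hB₂, hm₁, hm₂, hmY, hY, hind, hind', hc₁, hc₂, h0₁, h0₂,
    -, -⟩ := IsWholePlaneSLE.exists_drivingData κ
  obtain ⟨γ, hγ, hcurve⟩ := h κ hκ Ω P B₁ B₂ Y hP hB₁ hB₂ hm₁ hm₂ hmY hY hind hind' hc₁ hc₂ h0₁ h0₂
  exact ⟨Ω, mΩ, P, γ, hP, hγ, B₁, B₂, Y, hB₁, hB₂, hm₁, hm₂, hmY, hY, hind, hind', hcurve⟩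

end Literature.Probability.RandomPlanarGeometry
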